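import Mathlib
import Summits.Langlands.Langlands.Theses.IrreducibilityBySelfDuality
import Summits.Langlands.Langlands.Theorems.RegularTwistCM.Negative.ArchShadow
import Summits.Langlands.Langlands.Theorems.RegularTwistCM.Negative.ArchShadowParity
import Literature.NumberTheory.Automorphic.ClozelAlgebraicity
import Literature.NumberTheory.Automorphic.AutomorphicRepsGLOneArchParameter
import Literature.NumberTheory.Automorphic.KimExteriorSquareGL4ArchimedeanTwist

/-!
# Line `multiset-purity-parity` — checked skeleton for the crux
`Summit.Langlands.Langlands.Theses.IrreducibilityBySelfDuality.RegularTwistCM` (stmt-Langlands-14069, rank 3)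

Route `route-Langlands-IrreducibilityBySelfDuality`; idea card `Cruxes/RegularTwistCM/Ideas/multiset-purity-parity.md`
(ideator 2, round 1; triage r1-1/2/3: pass ×3); line card `Cruxes/RegularTwistCM/Lines/multiset-purity-parity.md`.
Planner crux-plan, generation 2 (independent pass; it supersedes the gen-1 file at this path and keeps its cut:
gen 1 = 5 stubs with `S.*`-wrapped signatures; gen 2 = 6 stubs with INLINED, self-contained signatures over tree
declarations — four of them are, token for token, the shared archimedean inputs of the sibling line
`unitary-mirror-parity`, so one `--supports` proof serves both lines — plus the kernel-checked compositions
`RegularTwistCM_of` (implication form) and `RegularTwistCM_proof` (closed form)).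

## The line

THE LEVER (proved here, `ap_of_pure`): Clozel's archimedean purity of the regular algebraic cuspidal `π` ON
MULTISETS (`stub_purity` = clause (iii) of the tree's named fact `Clozel1990_regularAlgebraic`, see
`stub_purity_of_clozel`) compares, at a complex place, the two 3-term arithmetic progressions
`{x - y + q, q, y - x + q}` (at `ι`) and `{x' - y' + q', q', y' - x' + q'}` (at `c ∘ ι`) that the adjoint identity
imposes on the Harish-Chandra parameter of `π` (`stub_adjointArchShadow`): MEANS give `q' = w - q`, an EXTREME
term gives `x' - y' = ±(x - y)`; with C-integrality and regularity of `π` this yields `a_ι := x - y ∈ ℤ ∖ {0}` and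
the UNIFORM PARITY `a_ι + a_ῑ ∈ 2ℤ` — hypothesis (iii) of the route's GL(1) lever `HalfIntegralTwistCM` — with no
`GL₂(ℂ)` unitary dual and no Langlands-parameter pairs of `σ₀` beyond the one integral pairing every line needs
(`stub_descentInfinityType`, the triage panel's cross-cutting input; see `integralPairing_of_wellFormed`).

## Registered stubs (the only `sorry`s; signatures are self-contained — to restate one verbatim in a
`Theorems/…` file use `open Filter NumberField Literature.NumberTheory.Automorphic`)

1. `stub_adjointArchShadow` — HC-LEVEL ADJOINT SHADOW (Gelbart–Jacquet 1978 Thm (9.3) at `∞` + Jacquet–Shalika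
   1981 II Thm 4.4): for cuspidal `π, σ₀, ν` on `GL₃, GL₂, GL₁` over ANY number field with the crux's a.e.
   identity `t_π = d · Ad(t_{σ₀})` (verbatim) and ANY archimedean parameters `χπ, χσ, χν`:
   `χσ ι = {x, y}`, `χν ι = {q}` ⟹ `χπ ι = {x - y + q, q, y - x + q}`. [XL/L; hardest; shared]
2. `stub_purity` — CLOZEL PURITY ON MULTISETS (Lemme 4.9) for a regular algebraic infinity type of a cuspidal
   `π` on `GL_n`: one `w ∈ ℤ` with `{a at c∘ι} = {w - a : a at ι}`. One line from the named fact
   (`stub_purity_of_clozel`, proved). [M given the fact; line-specific]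
3. `stub_descentInfinityType` — the cuspidal `GL₂` datum `σ₀` has a well-formed infinity type (= the tree's named
   fact `AutomorphicRepData.exists_hasInfinityType` on `σ₀`): the INTEGRAL PAIRING carrier. [L; shared]
4. `stub_centralCharacterDatum` — the central character of a cuspidal `GL_n` datum as a `GL(1)` datum with
   archimedean parameter `{Σ P ι}`. [M; shared]
5. `stub_halfIntegralTwist` — the route item `HalfIntegralTwistCM` (stmt-Langlands-14036, rank 4) BY NAME: the one
   use of `IsCMField` (Weil's unit criterion on `U²` + Chevalley 1951). [L; shared; closes with that item]
6. `stub_twistRealisation` — twisting a cuspidal `GL_n` datum by a `GL(1)` datum: Satake parameters multiply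
   (verbatim the crux's conclusion clause), archimedean parameters add. [L; shared]

## Glue (proved, sorry-free)
`ap_of_pure` (AP-means), `integralPairing_of_wellFormed` (all four differences `s_i ι - s_j ῑ` are integers once
ONE pairing is integral and `a_ι, a_ῑ ∈ ℤ`), the regular-algebraic certificate `isRegularAlgebraic_of_halfIntegral`
(two distinct half-integral exponent functions ⟹ `IsRegularAlgebraic`, the output type being well formed BECAUSE all
exponents are half-integral), `stub_purity_of_clozel`, and the compositions `RegularTwistCM_of`, `RegularTwistCM_proof`.

## Disproof used (`Cruxes/RegularTwistCM/Disproof.lean`, cycles 1–2; landed Negative lemmas imported above)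
`regularTwistCM_false_without_IsCMField` — honoured: `IsCMField` is consumed at exactly one stub,
`stub_halfIntegralTwist` (stubs 1–4, 6 hold over every number field); `regularTwistCM_false_without_RegularAlgebraic`
— honoured: `π.1.IsRegularAlgebraic` is consumed by `ap_of_pure` (C-integrality, `Nodup`) and by `stub_purity`
(purity is a clause of Clozel's fact FOR regular algebraic `π`; the Maass shadow `maassType_noAlgebraicTwist` is the
`a ∉ ℤ` case the AP lemma never reaches); refuted strengthenings `not_RegularTwistCMAlgebraicTwist` (F4) and
`not_RegularTwistCMGlobalPowerTwist` (F8) — avoided: the twisting datum `χ` is whatever `HalfIntegralTwistCM` returns,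
asked only for an exponent `p` with `p + s₁ ∈ ½ + ℤ` (it absorbs the Maass part of `ω_{σ₀}` place by place);
`squares_trick` / `squares_trick_tight` / `cmParity_obstructed` / `cmParity_sufficient` — respected: they live inside
`HalfIntegralTwistCM`, whose clause (iii) (the CM-parity input (P) of F6) is fed here by PURITY (`ap_of_pure`, third
conclusion: `b = ±a`, sign irrelevant), clause (ii) by the pairing stub; `complexPlace_twist_exists_free` — consistent:
locally nothing beyond integrality is used. No stub is an instance of a landed Negative lemma (all are consistency
statements this line satisfies; the imports above are the scratch check).
-/

set_option linter.dupNamespace false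

open scoped BigOperators
open Filter NumberField

namespace Summit.Langlands.Langlands.Cruxes.RegularTwistCM.MultisetPurityParity

open Literature.NumberTheory.Automorphic

/-! ## The six registered stubs (inlined, self-contained signatures; `sorry` lives only here) -/

/-- **Stub 1 — the adjoint archimedean shadow at Harish-Chandra level** (INPUT: Gelbart–Jacquet 1978
Thm (9.3)(2) at the archimedean places + Jacquet–Shalika 1981 II Thm 4.4, rendered on multisets; any number
field). Why true: `π` and the isobaric `Ad(σ₀) ⊠ ν` agree a.e., hence coincide (JS II 4.4) — for dihedral `σ₀`,
`Ad(σ₀)` is Eisenstein and the hypothesis is vacuous for CUSPIDAL `π` — so `π_w ≅ Ad(σ₀,w) ⊗ ν_w`, whose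
infinitesimal character at `ι` is read off `Ad ∘ φ_{σ₀,w}|_{ℂˣ}`: characters `z^{s₁-s₂} z̄^{t₁-t₂}, 1, z^{s₂-s₁} z̄^{t₂-t₁}`
(complex `w`), `{k-1, 0, 1-k}` for `Ad(D_k)` and `{s₁-s₂, 0, s₂-s₁}` for a principal series (real `w`); archimedean
parameters of BJ data are unique (`AutomorphicRepData.hasArchParameter_unique`, proved), so ANY `χπ, χσ, χν` are
the Harish-Chandra ones. Token-identical with `unitary-mirror-parity`'s `AdjointArchShadow`. Size XL/L. -/
theorem stub_adjointArchShadow :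
    ∀ (K : Type) [Field K] [NumberField K]
      (h1 : isCompact_glFiniteIntegralLevel 1 K) (hcpt₂ : isCompact_glFiniteIntegralLevel 2 K)
      (hcpt : isCompact_glFiniteIntegralLevel 3 K)
      (π : CuspidalAutomorphicRepData 3 K hcpt) (σ₀ : CuspidalAutomorphicRepData 2 K hcpt₂)
      (ν : CuspidalAutomorphicRepData 1 K h1),
      (∀ᶠ v in cofinite, ∀ α β : Multiset ℂ, π.1.HasSatakeParamAt v α →
        σ₀.1.HasSatakeParamAt v β → ∃ d : ℂ, ν.1.HasSatakeParamAt v {d} ∧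
          α = (((β ×ˢ β).map (fun p : ℂ × ℂ => p.1 * p.2⁻¹)).erase 1).map (fun c => d * c)) →
      ∀ (χπ χσ χν : (K →+* ℂ) → Multiset ℂ),
        π.1.HasArchParameter χπ → σ₀.1.HasArchParameter χσ → ν.1.HasArchParameter χν →
        ∀ (ι : K →+* ℂ) (x y q : ℂ), χσ ι = {x, y} → χν ι = {q} →
          χπ ι = {x - y + q, q, y - x + q} := by
  sorry

/-- **Stub 2 — Clozel's archimedean purity ON MULTISETS** (Clozel 1990 Lemme 4.9; clause (iii) of the tree's
named fact `Clozel1990_regularAlgebraic`, from which it follows in one line: `stub_purity_of_clozel` below). For a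
cuspidal `π` on `GL_n(𝔸_K)` and a regular algebraic infinity type `T` of `π` there is ONE `w ∈ ℤ` with
`{a-exponents of T at c∘ι} = {w - a : a at ι}` at every embedding `ι` (a statement about the archimedean
PARAMETER only — the pairing inside `T` is not constrained, and purity of the PAIRS would be false for re-paired
types). Why true: `π ⊗ |det|^{s}` unitary for a real `s`, generic unitary dual of `GL_n(ℂ)/GL_n(ℝ)`
(complementary series excluded by half-integrality) ⟹ `p_i + q_i = -2s =: w ∈ ℤ`. Size M (given the fact) /
L (from the unitary dual). THE LINE-SPECIFIC STUB. -/
theorem stub_purity :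
    ∀ (n : ℕ) (K : Type) [Field K] [NumberField K] (hcpt : isCompact_glFiniteIntegralLevel n K)
      (π : CuspidalAutomorphicRepData n K hcpt) (T : InfinityType K n),
      π.1.HasInfinityType T → T.IsRegularAlgebraic →
      ∃ w : ℤ, ∀ ι : K →+* ℂ, (T (ComplexEmbedding.conjugate ι)).map ArchWeight.a =
        ((T ι).map ArchWeight.a).map (fun a => (w : ℂ) - a) := by
  sorry

/-- **Stub 3 — the descent datum has a well-formed infinity type** (INPUT: Clozel 1990 §3.3 / Knapp Thm 5.44
for `n = 2`; = the tree's named fact `AutomorphicRepData.exists_hasInfinityType` on the instance `σ₀`). This is the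
carrier of the INTEGRAL PAIRING of `σ₀`'s Harish-Chandra parameter (`ArchWeight.exists_int_sub` + the conj-`swap`
clause of `IsWellFormed`), the archimedean input the triage panel proved independent of mirror / purity /
integrality (witness HC `{3/4, -1/4} / {1/4, -3/4}`). Why true: `σ₀,w` is an irreducible admissible
`(𝔤, K_w)`-module, its Langlands parameter restricted to `ℂˣ` is a sum of characters `z^{a} z̄^{b}`, `a - b ∈ ℤ`.
Token-identical with `unitary-mirror-parity`'s `DescentInfinityType`. Size L. -/
theorem stub_descentInfinityType :
    ∀ (K : Type) [Field K] [NumberField K] (hcpt₂ : isCompact_glFiniteIntegralLevel 2 K)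
      (σ₀ : CuspidalAutomorphicRepData 2 K hcpt₂), σ₀.1.exists_hasInfinityType := by
  sorry

/-- **Stub 4 — the central character as a `GL(1)` datum, archimedean clause** (Borel–Jacquet 1979 §4.6/5.7;
Clozel 1990 §3.3; Knapp Thm 5.44 at `n = 1`). For a cuspidal datum `π` on `GL_n(𝔸_K)` (`n ≥ 1`) with archimedean
parameter `P` there is a cuspidal `GL(1)` datum `ω` (its central character `ω_π`, a Hecke character —
`AutomorphicRepData.exists_centralCharacter`, proved) whose archimedean parameter at `ι` is `{Σ P ι}`: the scalar
`x · 1_n ∈ 𝔤𝔩_n(K_w)` acts through `x Σ P(ι_w) + x̄ Σ P(ῑ_w)` (`γ(1_n)(λ + ρ) = Σ λ_i`, `Σ ρ_i = 0`; the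
per-place form of the tree's `HasArchParameter.apply_one`), which is the differential of `ω_{π,w}`; then the
`GL(1)` dictionary (`hasArchParameter_glOne_of_eq_smul_one`, proved). Token-identical with `unitary-mirror-parity`'s
`CentralCharacterDatum`. Size M. -/
theorem stub_centralCharacterDatum :
    ∀ (n : ℕ) [NeZero n] (K : Type) [Field K] [NumberField K]
      (h1 : isCompact_glFiniteIntegralLevel 1 K) (hcpt : isCompact_glFiniteIntegralLevel n K)
      (π : CuspidalAutomorphicRepData n K hcpt) (P : (K →+* ℂ) → Multiset ℂ), π.1.HasArchParameter P →
      ∃ ω : CuspidalAutomorphicRepData 1 K h1, ω.1.HasArchParameter (fun ι => {(P ι).sum}) := by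
  sorry

/-- **Stub 5 — the CM lever, BY NAME**: the route's own crux `HalfIntegralTwistCM` (stmt-Langlands-14036, rank 4)
— half-integral re-twisting over a CM field from `GL(1)` data only: (i) `s₁ - s₂ ∈ ℤ`, (ii) integral pairing
`s₁ ι - s₁ ῑ ∈ ℤ`, (iii) UNIFORM PARITY of `(s₁-s₂)(ι) + (s₁-s₂)(ῑ)`, (iv) a `GL(1)` datum of exponent
`s₁ + s₂` ⟹ a `GL(1)` datum of exponent `p` with `p + s₁ ∈ ½ + ℤ`. Weil 1956 / Patrikis 2019 Lemma 2.1.1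
(`Patrikis2019_heckeCharacter_archType_iff_units`, named fact) on the SQUARES of the congruence units
(`squares_trick`; index 2 genuinely needed: `squares_trick_tight`) + Chevalley 1951 Thm 1 (`Chevalley1951.thm1_units`,
named fact); `IsCMField` is load-bearing exactly here (`cmParity_obstructed`, `archShadow_mixedParity_obstructed`),
and so is (ii) (`Theorems/HalfIntegralTwistCM/Negative/ArchParameterGLOne.lean`). Closing that item closes this
stub in one line (do not re-prove it inside this line). Size L. -/
theorem stub_halfIntegralTwist :
    Summit.Langlands.Langlands.Theses.IrreducibilityBySelfDuality.HalfIntegralTwistCM := by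
  sorry

/-- **Stub 6 — twisting a cuspidal `GL_n` datum by a `GL(1)` datum: Satake parameters multiply, archimedean
parameters add** (Borel–Jacquet 1979 5.7; Arthur–Clozel 1989 p. 172; Buzzard–Gee 2014 §3.1). For cuspidal `π` on
`GL_n(𝔸_K)` (`n ≥ 1`) with archimedean parameter `P` and a cuspidal `GL(1)` datum `χ` with archimedean parameter
`ι ↦ {p ι}` (a `GL(1)` datum IS a Hecke character: `W/W'` is a character of `𝔸ˣ` trivial on `Kˣ` by left
invariance, even when `W` contains `log |·|`-forms), there is a cuspidal `π' = π ⊗ (χ ∘ det)` with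
`t_{π',v} = c_v · t_{π,v}`, `t_{χ,v} = {c_v}` a.e. (IN TREE for the Hecke character behind `χ`:
`CuspidalAutomorphicRepData.exists_twist_hecke_hasSatakeParamAt`, `exists_heckeCharacter_glOne`) AND archimedean
parameter `ι ↦ P ι + p ι` (the general-differential form of the tree's `HasArchParameter.of_map_mulChar_detTwist`,
which is the case `‖·‖^s`; `isZFinite_mulChar_of_exp` already handles arbitrary differentials). No algebraicity /
unitarity of `χ` is assumed (Disproof F4/F8). Token-identical with `unitary-mirror-parity`'s `TwistRealisation`.
Size L. -/
theorem stub_twistRealisation :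
    ∀ (n : ℕ) [NeZero n] (K : Type) [Field K] [NumberField K]
      (h1 : isCompact_glFiniteIntegralLevel 1 K) (hcpt : isCompact_glFiniteIntegralLevel n K)
      (π : CuspidalAutomorphicRepData n K hcpt) (χ : CuspidalAutomorphicRepData 1 K h1)
      (P : (K →+* ℂ) → Multiset ℂ) (p : (K →+* ℂ) → ℂ),
      π.1.HasArchParameter P → χ.1.HasArchParameter (fun ι => {p ι}) →
      ∃ π' : CuspidalAutomorphicRepData n K hcpt,
        π'.1.HasArchParameter (fun ι => (P ι).map (· + p ι)) ∧
        ∀ᶠ v in cofinite, ∀ β : Multiset ℂ, π.1.HasSatakeParamAt v β →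
          ∃ c : ℂ, χ.1.HasSatakeParamAt v {c} ∧ π'.1.HasSatakeParamAt v (β.map (fun b => c * b)) := by
  sorry

/-! ## The stub statements by name (for the implication form `RegularTwistCM_of`; each `S.stub_X` is the
type of `stub_X` verbatim — the closed form `RegularTwistCM_proof` kernel-checks the agreement) -/

/-- Statement of `stub_adjointArchShadow` (see there). [folklore] -/
def S.stub_adjointArchShadow : Prop :=
  ∀ (K : Type) [Field K] [NumberField K]
    (h1 : isCompact_glFiniteIntegralLevel 1 K) (hcpt₂ : isCompact_glFiniteIntegralLevel 2 K)
    (hcpt : isCompact_glFiniteIntegralLevel 3 K)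
    (π : CuspidalAutomorphicRepData 3 K hcpt) (σ₀ : CuspidalAutomorphicRepData 2 K hcpt₂)
    (ν : CuspidalAutomorphicRepData 1 K h1),
    (∀ᶠ v in cofinite, ∀ α β : Multiset ℂ, π.1.HasSatakeParamAt v α →
      σ₀.1.HasSatakeParamAt v β → ∃ d : ℂ, ν.1.HasSatakeParamAt v {d} ∧
        α = (((β ×ˢ β).map (fun p : ℂ × ℂ => p.1 * p.2⁻¹)).erase 1).map (fun c => d * c)) →
    ∀ (χπ χσ χν : (K →+* ℂ) → Multiset ℂ),
      π.1.HasArchParameter χπ → σ₀.1.HasArchParameter χσ → ν.1.HasArchParameter χν →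
      ∀ (ι : K →+* ℂ) (x y q : ℂ), χσ ι = {x, y} → χν ι = {q} →
        χπ ι = {x - y + q, q, y - x + q}

/-- Statement of `stub_purity` (see there). [folklore] -/
def S.stub_purity : Prop :=
  ∀ (n : ℕ) (K : Type) [Field K] [NumberField K] (hcpt : isCompact_glFiniteIntegralLevel n K)
    (π : CuspidalAutomorphicRepData n K hcpt) (T : InfinityType K n),
    π.1.HasInfinityType T → T.IsRegularAlgebraic →
    ∃ w : ℤ, ∀ ι : K →+* ℂ, (T (ComplexEmbedding.conjugate ι)).map ArchWeight.a =
      ((T ι).map ArchWeight.a).map (fun a => (w : ℂ) - a)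

/-- Statement of `stub_descentInfinityType` (see there). [folklore] -/
def S.stub_descentInfinityType : Prop :=
  ∀ (K : Type) [Field K] [NumberField K] (hcpt₂ : isCompact_glFiniteIntegralLevel 2 K)
    (σ₀ : CuspidalAutomorphicRepData 2 K hcpt₂), σ₀.1.exists_hasInfinityType

/-- Statement of `stub_centralCharacterDatum` (see there). [folklore] -/
def S.stub_centralCharacterDatum : Prop :=
  ∀ (n : ℕ) [NeZero n] (K : Type) [Field K] [NumberField K]
    (h1 : isCompact_glFiniteIntegralLevel 1 K) (hcpt : isCompact_glFiniteIntegralLevel n K)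
    (π : CuspidalAutomorphicRepData n K hcpt) (P : (K →+* ℂ) → Multiset ℂ), π.1.HasArchParameter P →
    ∃ ω : CuspidalAutomorphicRepData 1 K h1, ω.1.HasArchParameter (fun ι => {(P ι).sum})

/-- Statement of `stub_halfIntegralTwist`: the route item, by name. [folklore] -/
def S.stub_halfIntegralTwist : Prop :=
  Summit.Langlands.Langlands.Theses.IrreducibilityBySelfDuality.HalfIntegralTwistCM

/-- Statement of `stub_twistRealisation` (see there). [folklore] -/
def S.stub_twistRealisation : Prop :=
  ∀ (n : ℕ) [NeZero n] (K : Type) [Field K] [NumberField K]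
    (h1 : isCompact_glFiniteIntegralLevel 1 K) (hcpt : isCompact_glFiniteIntegralLevel n K)
    (π : CuspidalAutomorphicRepData n K hcpt) (χ : CuspidalAutomorphicRepData 1 K h1)
    (P : (K →+* ℂ) → Multiset ℂ) (p : (K →+* ℂ) → ℂ),
    π.1.HasArchParameter P → χ.1.HasArchParameter (fun ι => {p ι}) →
    ∃ π' : CuspidalAutomorphicRepData n K hcpt,
      π'.1.HasArchParameter (fun ι => (P ι).map (· + p ι)) ∧
      ∀ᶠ v in cofinite, ∀ β : Multiset ℂ, π.1.HasSatakeParamAt v β →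
        ∃ c : ℂ, χ.1.HasSatakeParamAt v {c} ∧ π'.1.HasSatakeParamAt v (β.map (fun b => c * b))

/-! ## Glue 0 (proved): the line-specific stub is one line from the tree's named fact -/

/-- `stub_purity` is clause (iii) of `Clozel1990_regularAlgebraic` (`ComplexEmbedding.conjugate ι` is
`(starRingEnd ℂ).comp ι` by `rfl`). [cite: Clozel1990, Lemme 4.9] -/
theorem stub_purity_of_clozel (h : Clozel1990_regularAlgebraic) : S.stub_purity :=
  fun n K _ _ hcpt π T hT hTra => (h n K hcpt π ⟨T, hT, hTra⟩).2.2.1 T hT hTra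

/-! ## Glue 1 (proved): the AP-means lemma — purity on MULTISETS forces `|a'| = |a|` -/

/-- **AP-means.** If the rank-3 Harish-Chandra multiset at `ι` is `{x - y + p, p, y - x + p}`, C-integral
(`⊂ 1 + ℤ`, i.e. C-algebraic for `GL₃`) and regular (`Nodup`), and the multiset at `c ∘ ι`,
`{x' - y' + p', p', y' - x' + p'}`, is its mirror `w - ·` (Clozel purity on multisets), then `x - y ∈ ℤ`,
`x ≠ y`, and `x' - y' = ±(x - y)` — comparing the MEANS of the two 3-term arithmetic progressions gives
`p' = w - p`, comparing an EXTREME term gives the rest. No Langlands-parameter pairs, no unitary dual. [folklore] -/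
theorem ap_of_pure {x y p x' y' p' : ℂ} {w : ℤ}
    (hint : ∀ z ∈ ({x - y + p, p, y - x + p} : Multiset ℂ), ∃ k : ℤ, z = k + 1)
    (hreg : ({x - y + p, p, y - x + p} : Multiset ℂ).Nodup)
    (hpure : ({x' - y' + p', p', y' - x' + p'} : Multiset ℂ) =
      ({x - y + p, p, y - x + p} : Multiset ℂ).map (fun z => (w : ℂ) - z)) :
    (∃ k : ℤ, x - y = k) ∧ x ≠ y ∧ (x' - y' = x - y ∨ x' - y' = y - x) := by
  -- the means of the two arithmetic progressions
  have hsum := congrArg Multiset.sum hpure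
  simp only [Multiset.insert_eq_cons, Multiset.map_cons, Multiset.map_singleton,
    Multiset.sum_cons, Multiset.sum_singleton] at hsum
  have hp' : p' = w - p := by linear_combination hsum / 3
  -- regularity
  have hxy : x ≠ y := by
    intro h
    subst h
    simp at hreg
  -- integrality
  obtain ⟨k₁, hk₁⟩ := hint (x - y + p) (by simp)
  obtain ⟨k₂, hk₂⟩ := hint p (by simp)
  have hk : x - y = ((k₁ - k₂ : ℤ) : ℂ) := by
    push_cast
    linear_combination hk₁ - hk₂
  refine ⟨⟨k₁ - k₂, hk⟩, hxy, ?_⟩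
  -- the extreme term `w - (x - y + p)` lies in the multiset at `c ∘ ι`
  have hmem : ((w : ℂ) - (x - y + p)) ∈ ({x' - y' + p', p', y' - x' + p'} : Multiset ℂ) := by
    rw [hpure]
    simp
  simp only [Multiset.insert_eq_cons, Multiset.mem_cons, Multiset.mem_singleton] at hmem
  rcases hmem with h | h | h
  · right
    linear_combination -h - hp'
  · exfalso
    apply hxy
    linear_combination -h - hp'
  · left
    linear_combination h + hp'

/-! ## Glue 2 (proved): the integral pairing read off a well-formed rank-2 infinity type -/

/-- **All four differences are integral once one pairing is and `a_ι, a_ῑ ∈ ℤ`.** If the rank-2 infinity type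
`T₀` is well formed, its `a`-multiset at `ι` is `{s₁ ι, s₂ ι}` for ANY labelling `s₁, s₂`, and
`s₁ ῑ - s₂ ῑ ∈ ℤ`, then `s₁ ι - s₁ ῑ ∈ ℤ` (hypothesis (ii) of `HalfIntegralTwistCM`): the weight `q ∈ T₀ ι` with
`q.a = s₁ ι` has `q.b ∈ {s₁ ῑ, s₂ ῑ}` (conj-`swap` clause) and `q.a - q.b ∈ ℤ`. [folklore] -/
theorem integralPairing_of_wellFormed {K : Type} [Field K] {T₀ : InfinityType K 2} (hwf : T₀.IsWellFormed)
    {s₁ s₂ : (K →+* ℂ) → ℂ} (hs : ∀ ι, (T₀ ι).map ArchWeight.a = {s₁ ι, s₂ ι}) (ι : K →+* ℂ)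
    (ha : ∃ k : ℤ, s₁ (ComplexEmbedding.conjugate ι) - s₂ (ComplexEmbedding.conjugate ι) = k) :
    ∃ m : ℤ, s₁ ι - s₁ (ComplexEmbedding.conjugate ι) = m := by
  have hxmem : s₁ ι ∈ (T₀ ι).map ArchWeight.a := by
    rw [hs ι]
    simp
  obtain ⟨q, hq, hqa⟩ := Multiset.mem_map.mp hxmem
  have hb : (T₀ ι).map ArchWeight.b =
      {s₁ (ComplexEmbedding.conjugate ι), s₂ (ComplexEmbedding.conjugate ι)} := by
    have e : (T₀ (ComplexEmbedding.conjugate ι)).map ArchWeight.a = (T₀ ι).map ArchWeight.b :=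
      (congrArg (Multiset.map ArchWeight.a) (hwf.2 ι)).trans (Multiset.map_map _ _ _)
    rw [← e, hs]
  have hqb : q.b ∈ ({s₁ (ComplexEmbedding.conjugate ι), s₂ (ComplexEmbedding.conjugate ι)} : Multiset ℂ) := by
    rw [← hb]
    exact Multiset.mem_map_of_mem _ hq
  obtain ⟨m, hm⟩ := q.exists_int_sub
  rw [hqa] at hm
  simp only [Multiset.insert_eq_cons, Multiset.mem_cons, Multiset.mem_singleton] at hqb
  rcases hqb with h | h
  · exact ⟨m, by rw [← h]; exact hm⟩
  · obtain ⟨k', hk'⟩ := ha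
    rw [h] at hm
    exact ⟨m - k', by push_cast; linear_combination hm - hk'⟩

/-! ## Glue 3 (proved): the regular-algebraic certificate of a rank-2 datum with half-integral exponents -/

section Certificate

variable {K : Type} [Field K]

/-- An archimedean weight from two exponents in `1/2 + ℤ` (their difference is then an integer). [folklore] -/
def halfWt (x y : ℂ) (hx : ∃ m : ℤ, x - 1 / 2 = m) (hy : ∃ m : ℤ, y - 1 / 2 = m) : ArchWeight :=
  ⟨x, y, by
    obtain ⟨m, hm⟩ := hx
    obtain ⟨m', hm'⟩ := hy
    exact ⟨m - m', by push_cast; linear_combination hm - hm'⟩⟩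

@[simp] theorem halfWt_a (x y : ℂ) (hx : ∃ m : ℤ, x - 1 / 2 = m) (hy : ∃ m : ℤ, y - 1 / 2 = m) :
    (halfWt x y hx hy).a = x := rfl

@[simp] theorem halfWt_b (x y : ℂ) (hx : ∃ m : ℤ, x - 1 / 2 = m) (hy : ∃ m : ℤ, y - 1 / 2 = m) :
    (halfWt x y hx hy).b = y := rfl

/-- The rank-2 infinity type `ι ↦ {(e₁ ι, e₁ ῑ), (e₂ ι, e₂ ῑ)}` of two half-integral exponent functions. [folklore] -/
def typeOfExponents (e₁ e₂ : (K →+* ℂ) → ℂ) (h₁ : ∀ ι, ∃ m : ℤ, e₁ ι - 1 / 2 = m)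
    (h₂ : ∀ ι, ∃ m : ℤ, e₂ ι - 1 / 2 = m) : InfinityType K 2 :=
  fun ι => {halfWt (e₁ ι) (e₁ (ComplexEmbedding.conjugate ι)) (h₁ ι) (h₁ _),
    halfWt (e₂ ι) (e₂ (ComplexEmbedding.conjugate ι)) (h₂ ι) (h₂ _)}

variable (e₁ e₂ : (K →+* ℂ) → ℂ) (h₁ : ∀ ι, ∃ m : ℤ, e₁ ι - 1 / 2 = m)
  (h₂ : ∀ ι, ∃ m : ℤ, e₂ ι - 1 / 2 = m)

theorem typeOfExponents_map_a (ι : K →+* ℂ) :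
    (typeOfExponents e₁ e₂ h₁ h₂ ι).map ArchWeight.a = {e₁ ι, e₂ ι} := by
  simp [typeOfExponents]

theorem card_typeOfExponents (ι : K →+* ℂ) : Multiset.card (typeOfExponents e₁ e₂ h₁ h₂ ι) = 2 := by
  simp [typeOfExponents]

theorem typeOfExponents_conj (ι : K →+* ℂ) :
    typeOfExponents e₁ e₂ h₁ h₂ (ComplexEmbedding.conjugate ι) =
      (typeOfExponents e₁ e₂ h₁ h₂ ι).map ArchWeight.swap := by
  have hcc : ComplexEmbedding.conjugate (ComplexEmbedding.conjugate ι) = ι :=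
    ComplexEmbedding.involutive_conjugate K ι
  have k₁ : halfWt (e₁ (ComplexEmbedding.conjugate ι))
      (e₁ (ComplexEmbedding.conjugate (ComplexEmbedding.conjugate ι)))
      (h₁ (ComplexEmbedding.conjugate ι)) (h₁ _) =
      (halfWt (e₁ ι) (e₁ (ComplexEmbedding.conjugate ι)) (h₁ ι) (h₁ _)).swap :=
    ArchWeight.ext rfl (congrArg e₁ hcc)
  have k₂ : halfWt (e₂ (ComplexEmbedding.conjugate ι))
      (e₂ (ComplexEmbedding.conjugate (ComplexEmbedding.conjugate ι)))
      (h₂ (ComplexEmbedding.conjugate ι)) (h₂ _) =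
      (halfWt (e₂ ι) (e₂ (ComplexEmbedding.conjugate ι)) (h₂ ι) (h₂ _)).swap :=
    ArchWeight.ext rfl (congrArg e₂ hcc)
  show ({_, _} : Multiset ArchWeight) = Multiset.map ArchWeight.swap {_, _}
  rw [k₁, k₂]
  simp

/-- The infinity type of two half-integral exponent functions is well formed. [folklore] -/
theorem isWellFormed_typeOfExponents : (typeOfExponents e₁ e₂ h₁ h₂).IsWellFormed :=
  ⟨card_typeOfExponents e₁ e₂ h₁ h₂, typeOfExponents_conj e₁ e₂ h₁ h₂⟩

/-- … and C-algebraic for `GL₂` (all exponents in `1/2 + ℤ`). [folklore] -/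
theorem isCAlgebraic_typeOfExponents : (typeOfExponents e₁ e₂ h₁ h₂).IsCAlgebraic := by
  intro ι q hq
  simp only [typeOfExponents, Multiset.insert_eq_cons, Multiset.mem_cons, Multiset.mem_singleton] at hq
  rcases hq with rfl | rfl
  · obtain ⟨m, hm⟩ := h₁ ι
    obtain ⟨m', hm'⟩ := h₁ (ComplexEmbedding.conjugate ι)
    refine ⟨m, m', ?_, ?_⟩
    · rw [halfWt_a]; push_cast; linear_combination hm
    · rw [halfWt_b]; push_cast; linear_combination hm'
  · obtain ⟨m, hm⟩ := h₂ ι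
    obtain ⟨m', hm'⟩ := h₂ (ComplexEmbedding.conjugate ι)
    refine ⟨m, m', ?_, ?_⟩
    · rw [halfWt_a]; push_cast; linear_combination hm
    · rw [halfWt_b]; push_cast; linear_combination hm'

/-- … and regular as soon as the two exponents differ at every embedding. [folklore] -/
theorem isRegular_typeOfExponents (hne : ∀ ι, e₁ ι ≠ e₂ ι) : (typeOfExponents e₁ e₂ h₁ h₂).IsRegular := by
  intro ι
  rw [typeOfExponents_map_a]
  simp [hne ι]

include h₁ h₂ in
/-- **The regular-algebraic certificate.** A rank-2 Borel–Jacquet datum whose Harish-Chandra parameter at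
every embedding consists of two DISTINCT exponents in `1/2 + ℤ` is regular algebraic: the infinity type
`typeOfExponents` is well formed because all exponents are half-integral (no pairing datum needed on the
OUTPUT side, consistent with Disproof F9). [cite: Clozel1990, Déf. 1.8 and 3.12] -/
theorem isRegularAlgebraic_of_halfIntegral [NumberField K] {hcpt : isCompact_glFiniteIntegralLevel 2 K}
    (σ : CuspidalAutomorphicRepData 2 K hcpt) (hne : ∀ ι, e₁ ι ≠ e₂ ι)
    (harch : σ.1.HasArchParameter (fun ι => ({e₁ ι, e₂ ι} : Multiset ℂ))) :
    σ.1.IsRegularAlgebraic := by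
  have e : (fun ι => ({e₁ ι, e₂ ι} : Multiset ℂ)) =
      fun ι => (typeOfExponents e₁ e₂ h₁ h₂ ι).map ArchWeight.a :=
    funext fun ι => (typeOfExponents_map_a e₁ e₂ h₁ h₂ ι).symm
  rw [e] at harch
  exact ⟨typeOfExponents e₁ e₂ h₁ h₂, ⟨isWellFormed_typeOfExponents e₁ e₂ h₁ h₂, harch⟩,
    isCAlgebraic_typeOfExponents e₁ e₂ h₁ h₂, isRegular_typeOfExponents e₁ e₂ h₁ h₂ hne⟩

end Certificate

/-! ## The composition: stubs ⟹ crux (kernel-checked, no sorry of its own) -/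

/-- **`RegularTwistCM` from the six stubs (implication form).** Proof: take `π`'s regular algebraic infinity type
`T` (hypothesis) and `σ₀`'s well-formed infinity type `T₀` (stub 3), label its `a`-multisets `{s₁ ι, s₂ ι}`
arbitrarily, read `ν`'s exponent `q` (tree: `exists_hasArchParameter_glOne`, `card_eq_of_hasArchParameter`); stub 1
gives `(T ι).map a = {s₁ ι - s₂ ι + q ι, q ι, s₂ ι - s₁ ι + q ι}`; stub 2 gives the purity weight `w`;
`ap_of_pure` at each `ι` yields (i) `s₁ ι - s₂ ι ∈ ℤ`, `s₁ ι ≠ s₂ ι` and (iii) `a_ῑ = ±a_ι`;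
`integralPairing_of_wellFormed` yields (ii); stub 4 turns `ω_{σ₀}` into the `GL(1)` datum of exponent `s₁ + s₂`
(iv); stub 5 (= `HalfIntegralTwistCM`, the ONE use of `IsCMField`) produces the `GL(1)` datum `χ` of exponent
`p` with `p + s₁ ∈ ½ + ℤ`; stub 6 twists; `isRegularAlgebraic_of_halfIntegral` certifies. [folklore] -/
theorem RegularTwistCM_of (hA : S.stub_adjointArchShadow) (hP : S.stub_purity)
    (hD : S.stub_descentInfinityType) (hC : S.stub_centralCharacterDatum)
    (hH : S.stub_halfIntegralTwist) (hT : S.stub_twistRealisation) :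
    Summit.Langlands.Langlands.Theses.IrreducibilityBySelfDuality.RegularTwistCM := by
  intro K _ _ hK h1 hcpt₂ hcpt π σ₀ ν hRA hAd
  classical
  -- `π`'s regular algebraic infinity type (hypothesis of the crux)
  obtain ⟨T, hTinf, hTra⟩ := hRA
  -- stub 3: `σ₀`'s well-formed infinity type, with an arbitrary labelling of its `a`-multisets
  obtain ⟨T₀, hT₀⟩ := hD K hcpt₂ σ₀
  have hlab : ∀ ι : K →+* ℂ, ∃ x y : ℂ, (T₀ ι).map ArchWeight.a = {x, y} := fun ι =>
    Multiset.card_eq_two.mp (by rw [Multiset.card_map]; exact hT₀.1.1 ι)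
  choose s₁ s₂ hs using hlab
  -- tree: the exponent `q` of the `GL(1)` datum `ν`
  obtain ⟨χν, hχν⟩ := ν.1.exists_hasArchParameter_glOne
  have hq1 : ∀ ι : K →+* ℂ, ∃ q : ℂ, χν ι = {q} := fun ι =>
    Multiset.card_eq_one.mp (AutomorphicRepData.card_eq_of_hasArchParameter hχν ι)
  choose q hq using hq1
  -- stub 1: the adjoint shape of `π`'s Harish-Chandra parameter
  have hshape : ∀ ι : K →+* ℂ,
      (T ι).map ArchWeight.a = {s₁ ι - s₂ ι + q ι, q ι, s₂ ι - s₁ ι + q ι} := fun ι =>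
    hA K h1 hcpt₂ hcpt π σ₀ ν hAd (fun ι => (T ι).map ArchWeight.a) (fun ι => (T₀ ι).map ArchWeight.a) χν
      hTinf.2 hT₀.2 hχν ι (s₁ ι) (s₂ ι) (q ι) (hs ι) (hq ι)
  -- stub 2: multiset purity of `π`
  obtain ⟨w, hw⟩ := hP 3 K hcpt π T hTinf hTra
  -- AP-means at every embedding
  have key : ∀ ι : K →+* ℂ, (∃ k : ℤ, s₁ ι - s₂ ι = k) ∧ s₁ ι ≠ s₂ ι ∧
      (s₁ (ComplexEmbedding.conjugate ι) - s₂ (ComplexEmbedding.conjugate ι) = s₁ ι - s₂ ι ∨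
        s₁ (ComplexEmbedding.conjugate ι) - s₂ (ComplexEmbedding.conjugate ι) = s₂ ι - s₁ ι) := by
    intro ι
    refine ap_of_pure (p := q ι) (p' := q (ComplexEmbedding.conjugate ι)) (w := w) ?_ ?_ ?_
    · intro z hz
      rw [← hshape ι] at hz
      obtain ⟨r, hr, rfl⟩ := Multiset.mem_map.mp hz
      obtain ⟨k, l, hk, -⟩ := hTra.1 ι r hr
      exact ⟨k, by rw [hk]; norm_num⟩
    · rw [← hshape ι]
      exact hTra.2 ι
    · rw [← hshape (ComplexEmbedding.conjugate ι), ← hshape ι]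
      exact hw ι
  -- hypotheses (i)–(iii) of the CM lever, for the exponent functions `s₁`, `s₂` of `σ₀`
  have hi : ∀ ι : K →+* ℂ, ∃ k : ℤ, s₁ ι - s₂ ι = k := fun ι => (key ι).1
  have hii : ∀ ι : K →+* ℂ, ∃ m : ℤ, s₁ ι - s₁ (ComplexEmbedding.conjugate ι) = m := fun ι =>
    integralPairing_of_wellFormed hT₀.1 hs ι (hi (ComplexEmbedding.conjugate ι))
  have hiii : ∀ ι : K →+* ℂ, ∃ m : ℤ, (s₁ ι - s₂ ι) +
      (s₁ (ComplexEmbedding.conjugate ι) - s₂ (ComplexEmbedding.conjugate ι)) = 2 * m := by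
    intro ι
    obtain ⟨k, hk⟩ := (key ι).1
    rcases (key ι).2.2 with h | h
    · exact ⟨k, by rw [h, hk]; ring⟩
    · exact ⟨0, by rw [h]; push_cast; ring⟩
  -- stub 4: the central character of `σ₀` as a `GL(1)` datum of exponent `s₁ + s₂` — hypothesis (iv)
  obtain ⟨ω, hω⟩ := hC 2 K h1 hcpt₂ σ₀ (fun ι => (T₀ ι).map ArchWeight.a) hT₀.2
  have eω : (fun ι => ({s₁ ι + s₂ ι} : Multiset ℂ)) =
      fun ι => {((T₀ ι).map ArchWeight.a).sum} := by
    funext ι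
    rw [hs ι]
    simp
  have hω' : ω.1.HasArchParameter (fun ι => ({s₁ ι + s₂ ι} : Multiset ℂ)) := by
    rw [eω]
    exact hω
  -- stub 5: the CM lever (the ONE use of `IsCMField`)
  obtain ⟨χ, p, hχ, hp⟩ := hH K hK h1 s₁ s₂ hi hii hiii ⟨ω, hω'⟩
  -- the twisted exponents are distinct half-integers
  have he₁ : ∀ ι : K →+* ℂ, ∃ m : ℤ, s₁ ι + p ι - 1 / 2 = m := fun ι => by
    obtain ⟨m, hm⟩ := hp ι
    exact ⟨m, by linear_combination hm⟩
  have he₂ : ∀ ι : K →+* ℂ, ∃ m : ℤ, s₂ ι + p ι - 1 / 2 = m := fun ι => by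
    obtain ⟨m, hm⟩ := hp ι
    obtain ⟨k, hk⟩ := (key ι).1
    exact ⟨m - k, by push_cast; linear_combination hm - hk⟩
  have hne : ∀ ι : K →+* ℂ, s₁ ι + p ι ≠ s₂ ι + p ι := fun ι h =>
    (key ι).2.1 (by linear_combination h)
  -- stub 6: the twist `σ = σ₀ ⊗ χ`, with its archimedean parameter
  obtain ⟨σ, hσa, hσt⟩ := hT 2 K h1 hcpt₂ σ₀ χ (fun ι => (T₀ ι).map ArchWeight.a) p hT₀.2 hχ
  have eσ : (fun ι => ({s₁ ι + p ι, s₂ ι + p ι} : Multiset ℂ)) =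
      fun ι => ((T₀ ι).map ArchWeight.a).map (· + p ι) := by
    funext ι
    rw [hs ι]
    simp
  have hσa' : σ.1.HasArchParameter (fun ι => ({s₁ ι + p ι, s₂ ι + p ι} : Multiset ℂ)) := by
    rw [eσ]
    exact hσa
  -- the certificate
  exact ⟨σ, χ, isRegularAlgebraic_of_halfIntegral (fun ι => s₁ ι + p ι) (fun ι => s₂ ι + p ι) he₁ he₂ σ
    hne hσa', hσt⟩

/-- **The crux from the six stubs (closed form; sorries live only inside `stub_*`).** Applying the implication
form to the stub theorems kernel-checks that each inlined stub signature IS the statement `S.stub_X`. [folklore] -/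
theorem RegularTwistCM_proof :
    Summit.Langlands.Langlands.Theses.IrreducibilityBySelfDuality.RegularTwistCM :=
  RegularTwistCM_of stub_adjointArchShadow stub_purity stub_descentInfinityType stub_centralCharacterDatum
    stub_halfIntegralTwist stub_twistRealisation

end Summit.Langlands.Langlands.Cruxes.RegularTwistCM.MultisetPurityParity
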